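import Mathlib
import Summits.KontsevichZagierPeriods.KontsevichZagierPeriods.Theorems.InverseLandauTateLiftingSqrtAffineSector

/-!
# `TateLifting` (stmt-KontsevichZagierPeriods-9129), line `Sketch` — stub 40
# `tateLifting_conicChart`

EULER'S SECANT SUBSTITUTION THROUGH A `K`-POINT OF A CONIC. Let `K = ℚ̄ ∩ ℝ = algebraicClosure ℚ ℝ`,
`a, b, c, x₀, y₀ ∈ K` with `y₀² = q(x₀)`, `q = aX² + bX + c` a non-degenerate conic (`b² ≠ 4ac`),
and let `σ ⊆ ℝ¹` be `ℚ`-semialgebraic with `x ≠ x₀`, `q(x) > 0` on `σ`. For `x ∈ σ` put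
`s = √q(x)` and `t = (s − y₀)/(x − x₀)` (the slope of the secant through `(x₀, y₀)` and `(x, s)`).

* `x ↦ t` is a `ℚ`-semialgebraic function on `σ` (closure of semialgebraic functions under
  `+, ·, −, /, √`, Tarski–Seidenberg; the constants are real algebraic);
* KEY IDENTITY `(t² − a)(x − x₀) = 2ax₀ + b − 2y₀t` (from `t(x − x₀) = s − y₀` and
  `s² − y₀² = (x − x₀)(a(x + x₀) + b)`), whence `t² − a ≠ 0` (otherwise `(2ax₀ + b)² = 4a·q(x₀)`,
  i.e. `b² = 4ac`), the inverse chart `x = x₀ + (2ax₀ + b − 2y₀t)/(t² − a)` and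
  `s = y₀ + t(x − x₀)`: the conic is unirational over `K` by the pencil of lines through `(x₀, y₀)`.

References: M. Kontsevich, D. Zagier, *Periods* (2001), §1.2 rule (2); L. Euler, *Institutiones
calculi integralis* I (1768), §§ 88–99 (Euler substitutions).
-/

noncomputable section

open MeasureTheory Set
open Literature.NumberTheory.Transcendental
open Literature.ModelTheory.ExponentialFields (IsSemialgebraic)

namespace Summit.KontsevichZagierPeriods.InverseLandau

namespace ConicChart

/-- **Key identity of Euler's secant substitution.** If `s² = q(x)`, `y₀² = q(x₀)`
(`q = aX² + bX + c`), `x ≠ x₀` and `t(x − x₀) = s − y₀`, then `(t² − a)(x − x₀) = 2ax₀ + b − 2y₀t`.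
[folklore] -/
theorem cc_key {a b c x₀ y₀ x s t : ℝ} (hs : s ^ 2 = a * x ^ 2 + b * x + c)
    (hy : y₀ ^ 2 = a * x₀ ^ 2 + b * x₀ + c) (hx : x ≠ x₀) (ht : t * (x - x₀) = s - y₀) :
    (t ^ 2 - a) * (x - x₀) = 2 * a * x₀ + b - 2 * y₀ * t := by
  have hx' : x - x₀ ≠ 0 := sub_ne_zero.2 hx
  refine mul_left_cancel₀ hx' ?_
  linear_combination (t * (x - x₀) + s + y₀) * ht + hs - hy

/-- **Non-degeneracy of the secant chart.** Under the hypotheses of `cc_key` and `b² ≠ 4ac`,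
`t² ≠ a`: otherwise `2y₀t = 2ax₀ + b`, and squaring gives `4a·q(x₀) = (2ax₀ + b)²`, i.e.
`b² = 4ac`. [folklore] -/
theorem cc_ne {a b c x₀ y₀ x s t : ℝ} (hs : s ^ 2 = a * x ^ 2 + b * x + c)
    (hy : y₀ ^ 2 = a * x₀ ^ 2 + b * x₀ + c) (hD : b ^ 2 - 4 * a * c ≠ 0) (hx : x ≠ x₀)
    (ht : t * (x - x₀) = s - y₀) : t ^ 2 - a ≠ 0 := by
  intro h0
  have hkey := cc_key hs hy hx ht
  apply hD
  linear_combination ((x - x₀) * (2 * a * x₀ + b + 2 * y₀ * t) + 4 * y₀ ^ 2) * h0 -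
    (2 * a * x₀ + b + 2 * y₀ * t) * hkey + 4 * a * hy

/-- **The inverse of the secant chart**: `x = x₀ + (2ax₀ + b − 2y₀t)/(t² − a)` (the key identity
divided by `t² − a ≠ 0`). [folklore] -/
theorem cc_inv {a b c x₀ y₀ x s t : ℝ} (hs : s ^ 2 = a * x ^ 2 + b * x + c)
    (hy : y₀ ^ 2 = a * x₀ ^ 2 + b * x₀ + c) (hD : b ^ 2 - 4 * a * c ≠ 0) (hx : x ≠ x₀)
    (ht : t * (x - x₀) = s - y₀) :
    x₀ + (2 * a * x₀ + b - 2 * y₀ * t) / (t ^ 2 - a) = x := by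
  have h1 := cc_ne hs hy hD hx ht
  have hkey := cc_key hs hy hx ht
  have hq : (2 * a * x₀ + b - 2 * y₀ * t) / (t ^ 2 - a) = x - x₀ := by
    rw [div_eq_iff h1]
    linear_combination -hkey
  rw [hq]
  ring

/-- **Euler's secant substitution, pointwise**: with `s = √q(x)` (`q(x) > 0`) and
`t = (s − y₀)/(x − x₀)`, one has `t² − a ≠ 0`, `x = x₀ + (2ax₀ + b − 2y₀t)/(t² − a)` and
`s = y₀ + t(x − x₀)`. [folklore] -/
theorem cc_point {a b c x₀ y₀ x : ℝ} (hy : y₀ ^ 2 = a * x₀ ^ 2 + b * x₀ + c)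
    (hD : b ^ 2 - 4 * a * c ≠ 0) (hx : x ≠ x₀) (hpos : 0 < a * x ^ 2 + b * x + c) :
    ((Real.sqrt (a * x ^ 2 + b * x + c) - y₀) / (x - x₀)) ^ 2 - a ≠ 0 ∧
      x₀ + (2 * a * x₀ + b -
          2 * y₀ * ((Real.sqrt (a * x ^ 2 + b * x + c) - y₀) / (x - x₀))) /
        (((Real.sqrt (a * x ^ 2 + b * x + c) - y₀) / (x - x₀)) ^ 2 - a) = x ∧
      y₀ + ((Real.sqrt (a * x ^ 2 + b * x + c) - y₀) / (x - x₀)) * (x - x₀) =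
        Real.sqrt (a * x ^ 2 + b * x + c) := by
  have hs : Real.sqrt (a * x ^ 2 + b * x + c) ^ 2 = a * x ^ 2 + b * x + c :=
    Real.sq_sqrt hpos.le
  have hx' : x - x₀ ≠ 0 := sub_ne_zero.2 hx
  have ht : (Real.sqrt (a * x ^ 2 + b * x + c) - y₀) / (x - x₀) * (x - x₀) =
      Real.sqrt (a * x ^ 2 + b * x + c) - y₀ := div_mul_cancel₀ _ hx'
  exact ⟨cc_ne hs hy hD hx ht, cc_inv hs hy hD hx ht, by rw [ht]; ring⟩

/-- **The secant slope is semialgebraic**: for real-algebraic `a, b, c, x₀, y₀` and a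
`ℚ`-semialgebraic `σ ⊆ {x ≠ x₀}`, `x ↦ (√(ax² + bx + c) − y₀)/(x − x₀)` is a `ℚ`-semialgebraic
function on `σ` (coordinates, algebraic constants, `+, ·, −, /, √`; Tarski–Seidenberg).
[cite: KontsevichZagier2001, §1.1] -/
theorem cc_isSemialgebraicFunOn (a b c x₀ y₀ : algebraicClosure ℚ ℝ) {σ : Set (Fin 1 → ℝ)}
    (hσ : IsSemialgebraic ℚ σ) (hne : ∀ x ∈ σ, x 0 ≠ (x₀ : ℝ)) :
    IsSemialgebraicFunOn ℚ σ
      (fun x => (Real.sqrt ((a : ℝ) * x 0 ^ 2 + (b : ℝ) * x 0 + c) - y₀) / (x 0 - x₀)) := by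
  have hX : IsSemialgebraicFunOn ℚ σ (fun x : Fin 1 → ℝ => x 0) := isSemialgebraicFunOn_apply hσ 0
  have ha := isSemialgebraicFunOn_const_of_isAlgebraic hσ (mem_algebraicClosure_iff.1 a.2)
  have hb := isSemialgebraicFunOn_const_of_isAlgebraic hσ (mem_algebraicClosure_iff.1 b.2)
  have hc := isSemialgebraicFunOn_const_of_isAlgebraic hσ (mem_algebraicClosure_iff.1 c.2)
  have hx₀ := isSemialgebraicFunOn_const_of_isAlgebraic hσ (mem_algebraicClosure_iff.1 x₀.2)
  have hy₀ := isSemialgebraicFunOn_const_of_isAlgebraic hσ (mem_algebraicClosure_iff.1 y₀.2)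
  have hq : IsSemialgebraicFunOn ℚ σ
      (fun x : Fin 1 → ℝ => (a : ℝ) * x 0 ^ 2 + (b : ℝ) * x 0 + c) :=
    ((ha.fun_mul (hX.fun_pow 2)).fun_add (hb.fun_mul hX)).fun_add hc
  have hsq := IsSemialgebraicFunOn.sqrt_holds hq
  exact ((hsq.fun_sub hy₀).div (hX.fun_sub hx₀) fun x hx => sub_ne_zero.2 (hne x hx)).congr
    fun x _ => rfl

end ConicChart

open ConicChart in
/-- **Euler's secant substitution through a `K`-point of the conic `y² = ax² + bx + c`**
(`K = ℚ̄ ∩ ℝ`, `b² ≠ 4ac`, `(x₀, y₀) ∈ K²` on the conic): on a `ℚ`-semialgebraic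
`σ ⊆ {x ≠ x₀, q(x) > 0}` the secant slope `t = (√q(x) − y₀)/(x − x₀)` is a `ℚ`-semialgebraic
function, `t² ≠ a`, and the chart inverts rationally: `x = x₀ + (2ax₀ + b − 2y₀t)/(t² − a)`,
`√q(x) = y₀ + t(x − x₀)` — the change of variables reducing `[σ, R(x, √q(x))]` to a rational
integrand with real-algebraic coefficients (Kontsevich–Zagier's rule (2)).
[cite: KontsevichZagier2001, §1.2 rule (2)] -/
theorem tateLifting_conicChart :
    ∀ (a b c x₀ y₀ : algebraicClosure ℚ ℝ) (σ : Set (Fin 1 → ℝ)), IsSemialgebraic ℚ σ →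
      (y₀ : ℝ) ^ 2 = (a : ℝ) * (x₀ : ℝ) ^ 2 + (b : ℝ) * (x₀ : ℝ) + c →
      (b : ℝ) ^ 2 - 4 * (a : ℝ) * c ≠ 0 →
      (∀ x ∈ σ, x 0 ≠ (x₀ : ℝ)) → (∀ x ∈ σ, 0 < (a : ℝ) * x 0 ^ 2 + (b : ℝ) * x 0 + c) →
      IsSemialgebraicFunOn ℚ σ
          (fun x => (Real.sqrt ((a : ℝ) * x 0 ^ 2 + (b : ℝ) * x 0 + c) - y₀) / (x 0 - x₀)) ∧
        ∀ x ∈ σ,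
          ((Real.sqrt ((a : ℝ) * x 0 ^ 2 + (b : ℝ) * x 0 + c) - y₀) / (x 0 - x₀)) ^ 2 - a ≠ 0 ∧
          (x₀ : ℝ) + (2 * (a : ℝ) * x₀ + b -
              2 * (y₀ : ℝ) *
                ((Real.sqrt ((a : ℝ) * x 0 ^ 2 + (b : ℝ) * x 0 + c) - y₀) / (x 0 - x₀))) /
            (((Real.sqrt ((a : ℝ) * x 0 ^ 2 + (b : ℝ) * x 0 + c) - y₀) / (x 0 - x₀)) ^ 2 - a) =
            x 0 ∧
          (y₀ : ℝ) +
              ((Real.sqrt ((a : ℝ) * x 0 ^ 2 + (b : ℝ) * x 0 + c) - y₀) / (x 0 - x₀)) * (x 0 - x₀) =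
            Real.sqrt ((a : ℝ) * x 0 ^ 2 + (b : ℝ) * x 0 + c) := by
  intro a b c x₀ y₀ σ hσ hy hD hne hpos
  exact ⟨cc_isSemialgebraicFunOn a b c x₀ y₀ hσ hne,
    fun x hx => cc_point hy hD (hne x hx) (hpos x hx)⟩

end Summit.KontsevichZagierPeriods.InverseLandau

end
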